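import Mathlib
import Literature.Analysis.FluidPDE.SuitableWeak
import Literature.Analysis.FluidPDE.WeakGradientSlicing
import Literature.Analysis.FluidPDE.CKNInterpolationEstimate
import Literature.Analysis.FunctionSpaces.SobolevDomainProofs
import Summits.NavierStokesRegularity.NavierStokesRegularity.Theorems.EulerZoomLiouvillePowerGaugeEulerLiouvilleBackwardTools
import Summits.NavierStokesRegularity.NavierStokesRegularity.Theorems.EulerZoomLiouvillePowerGaugeEulerLiouvilleTimePeriodicTools
import Summits.NavierStokesRegularity.NavierStokesRegularity.Theorems.EulerZoomLiouvillePowerGaugeEulerLiouvilleSteadyTools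
import Summits.NavierStokesRegularity.NavierStokesRegularity.Theorems.EulerZoomLiouvillePowerGaugeEulerLiouvilleAllRhoStrata
import Summits.NavierStokesRegularity.NavierStokesRegularity.Theorems.EulerZoomLiouvillePowerGaugeEulerLiouvilleSelfSimilarShiftedHomogeneous
import Summits.NavierStokesRegularity.NavierStokesRegularity.Theorems.EulerZoomLiouvillePowerGaugeEulerLiouvilleSelfSimilarPastExtension
import HarnessLib

/-!
# Crux E `PowerGaugeEulerLiouville` (stmt-NavierStokesRegularity-19832): members with a STEADY PAST are trivial

Route `EulerZoomLiouville` (NavierStokesRegularity), crux E = Seregin's power-gauged ancient-Euler Liouville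
statement.  A member `(u, p, H, c)` of the class (suitable weak Euler pair on the slab `(−∞,0) × ℝ³`, weak
spatial gradient `H`, gauges `a^{2ρ} A(a) + a^{ρ} E(a) + a^{2ρ} D(a) ≤ c` at the origin, `ρ > 0`) which is
TIME-INDEPENDENT BEFORE SOME TIME `T₁ ≤ 0` — `u(τ, ·) = v` for every `τ < T₁`, `v : ℝ³ → ℝ³` ARBITRARY (no
regularity, no decay assumed) — vanishes a.e. on the whole slab (`PastSteady.ae_eq_zero_of_gauge_of_pastSteady`).
The tree's rung B (`powerGaugeEulerLiouville_steady`, `…Steady.lean`) is the case `T₁ = 0` with `u` LITERALLY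
`fun _ => v`; the present file removes both restrictions, so that every member which is steady in the far
past — in particular every member which is exactly self-similar about ANY space–time point `(T, x₀)`, `T ≥ T₁`,
before `T₁` with a critically HOMOGENEOUS profile `V(sy) = s^{-(1+ρ)} V(y)` (such a collapse is
time-independent: `Shifted.selfSimilarCollapse_shifted_eq_of_homogeneous`), the family the interim lead's
census v23–v27 listed as NOT covered ("past-steady ≠ steady") — is trivial
(`PastSteady.ae_eq_zero_of_gauge_of_pastHomogeneous`).

Proof (large-scale arithmetic of the gauges + slicing; the Euler system enters only through the
backward energy monotonicity of the class used in the last step).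
(1) For a.e. `τ < 0` the slice `H(τ)` is a weak derivative of `u(τ)` on `ℝ³`
(`HasWeakSpatialGradientOn.ae_hasWeakFDerivOn_slice`); fix such a `τ₀ < T₁` and put `G := H(τ₀)`, a weak
derivative of `v`; by uniqueness of weak derivatives (`HasWeakFDerivOn.unique_holds`) every good slice
`τ < T₁` has `H(τ) = G` a.e.
(2) The `E`-gauge gives `∫∫_{(−b²,0)×B_b} |H|²_F ≤ c b^{1−ρ}` (`TimePeriodic.setLIntegral_window_le_of_gaugeE`);
Chebyshev in time (`Backward.mul_volume_sep_le_setLIntegral_prod`) on the window `(−b², T₁)` of length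
`≥ b²/2` (for `b² ≥ 2|T₁|`) produces a good slice there with `∫_{B_b} |G|²_F ≤ 4(c+1) b^{−1−ρ}`; letting
`b → ∞` on a fixed ball, `G = 0` a.e.
(3) Hence `v` has the zero weak derivative on `ℝ³`, so `v` is a.e. a constant
(`ae_eq_const_of_hasWeakFDerivOn_zero`), and the `A`-gauge on the slice `τ₀` kills the constant
(`Backward.lintegral_ball_le_of_gaugeA`, `Shifted.growth_of_growth_le`, `NoDrift.eq_zero_of_const_of_lintegral_ball_le`):
`v = 0` a.e.
(4) So `∫ |u(s)|² = 0` for every `s < T₁`: the member has an energy-quiescent past and vanishes by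
`ae_eq_zero_of_gauge_of_energyVanishing_allRho`.
WHAT THIS IS NOT: not NS regularity, not the crux `E` — one more WEAK (regularity-free) stratum of it, for the
lead skeleton `Cruxes/PowerGaugeEulerLiouville/Lines/birth.lean` (interim LEAD ns-typeII-p2 g9).
-/

noncomputable section

set_option linter.dupNamespace false

open MeasureTheory Set Filter Topology Metric Function TopologicalSpace
open scoped ENNReal NNReal

namespace Summit.NavierStokesRegularity.NavierStokesRegularity.Theorems.PowerGaugeEulerLiouville.PastSteady

open Literature.Analysis Literature.Analysis.FunctionSpaces Literature.Analysis.FluidPDE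

/-- **Members of the power-gauged class with a STEADY PAST are trivial.**  Let `(u, p)` be a suitable
weak Euler pair on `(−∞,0) × ℝ³` with weak spatial gradient `H` and gauges
`a^{2ρ} A(a) + a^{ρ} E(a) + a^{2ρ} D(a) ≤ c` (`ρ > 0`), and suppose `u(τ, ·) = v` for every `τ < T₁`, some
`T₁ ≤ 0` and some `v : ℝ³ → ℝ³` (no regularity or decay assumed).  Then `u = 0` a.e. on the slab:
the `E`-gauge forces the (unique) weak gradient of `v` to vanish, so `v` is a.e. constant, the `A`-gauge
kills the constant, and an energy-quiescent past makes the member trivial.  Generalises the tree's rung B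
`powerGaugeEulerLiouville_steady` (`T₁ = 0`, `u = fun _ => v`). [folklore] -/
theorem ae_eq_zero_of_gauge_of_pastSteady {ρ : ℝ} (hρ : 0 < ρ)
    {u : ℝ → EuclideanSpace ℝ (Fin 3) → EuclideanSpace ℝ (Fin 3)} {p : ℝ → EuclideanSpace ℝ (Fin 3) → ℝ}
    {H : ℝ → EuclideanSpace ℝ (Fin 3) → EuclideanSpace ℝ (Fin 3) →L[ℝ] EuclideanSpace ℝ (Fin 3)} {c : ℝ≥0}
    (hsw : IsSuitableWeakSolutionOn (slab (EuclideanSpace ℝ (Fin 3)) (Iio 0) isOpen_Iio) 0 0 u p)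
    (hH : HasWeakSpatialGradientOn (slab (EuclideanSpace ℝ (Fin 3)) (Iio 0) isOpen_Iio) u H)
    (hc : ∀ a : ℝ, 0 < a → ENNReal.ofReal (a ^ (2 * ρ)) * cknA a (0 : ℝ × EuclideanSpace ℝ (Fin 3)) u +
        ENNReal.ofReal (a ^ ρ) * cknE a (0 : ℝ × EuclideanSpace ℝ (Fin 3)) H +
        ENNReal.ofReal (a ^ (2 * ρ)) * cknD a (0 : ℝ × EuclideanSpace ℝ (Fin 3)) p ≤ (c : ℝ≥0∞))
    {T₁ : ℝ} (hT₁ : T₁ ≤ 0) {v : EuclideanSpace ℝ (Fin 3) → EuclideanSpace ℝ (Fin 3)}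
    (hv : ∀ τ : ℝ, τ < T₁ → u τ = v) :
    uncurry u =ᵐ[volume.restrict (Iio (0 : ℝ) ×ˢ (univ : Set (EuclideanSpace ℝ (Fin 3))))] 0 := by
  have hE : ∀ a : ℝ, 0 < a →
      ENNReal.ofReal (a ^ ρ) * cknE a (0 : ℝ × EuclideanSpace ℝ (Fin 3)) H ≤ (c : ℝ≥0∞) :=
    fun a ha => le_trans (le_trans le_add_self le_self_add) (hc a ha)
  have hA : ∀ a : ℝ, 0 < a → ENNReal.ofReal (a ^ (2 * ρ)) *
      cknA a (0 : ℝ × EuclideanSpace ℝ (Fin 3)) u ≤ (c : ℝ≥0∞) :=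
    fun a ha => le_trans (le_trans le_self_add le_self_add) (hc a ha)
  -- ## (1) good slices: a.e. `τ < 0`, `H(τ)` is a weak derivative of `u(τ)` on `ℝ³`
  have hslice : ∀ᵐ τ ∂(volume.restrict (Iio (0 : ℝ))),
      HasWeakFDerivOn (⊤ : Opens (EuclideanSpace ℝ (Fin 3))) volume (u τ) (H τ) := by
    -- adapted from Theorems/EulerZoomLiouvillePowerGaugeEulerLiouvilleBackwardVanishingGeneralRho.lean
    have hcov : Iio (0 : ℝ) = ⋃ N : ℕ, Ioo (-((N : ℝ) + 1)) 0 := by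
      ext τ
      simp only [mem_Iio, mem_iUnion, mem_Ioo]
      constructor
      · intro hτ
        obtain ⟨N, hN⟩ := exists_nat_gt (-τ)
        exact ⟨N, by linarith, hτ⟩
      · rintro ⟨N, -, hτ⟩; exact hτ
    rw [hcov, ae_restrict_iUnion_iff]
    intro N
    have hmono : slab (EuclideanSpace ℝ (Fin 3)) (Ioo (-((N : ℝ) + 1)) 0) isOpen_Ioo ≤
        slab (EuclideanSpace ℝ (Fin 3)) (Iio 0) isOpen_Iio := slab_mono Ioo_subset_Iio_self
    exact (hH.mono hmono).ae_hasWeakFDerivOn_slice (Ω := ⊤)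
  set Good : Set ℝ := {τ | HasWeakFDerivOn (⊤ : Opens (EuclideanSpace ℝ (Fin 3))) volume (u τ) (H τ)}
    with hGood
  have hGnull : volume (Goodᶜ ∩ Iio 0) = 0 := by
    have h := hslice
    rw [ae_iff, Measure.restrict_apply' measurableSet_Iio] at h
    simpa only [hGood, compl_setOf] using h
  -- ## reference slice `τ₀ ∈ (T₁ - 1, T₁)` and the weak gradient `G := H τ₀` of `v`
  obtain ⟨τ₀, hτ₀I, hτ₀G⟩ : ∃ τ, τ ∈ Ioo (T₁ - 1) T₁ ∧ τ ∈ Good := by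
    by_contra hne
    push Not at hne
    have hsub : Ioo (T₁ - 1) T₁ ⊆ Goodᶜ ∩ Iio 0 :=
      fun τ hτ => ⟨hne τ hτ, lt_of_lt_of_le hτ.2 hT₁⟩
    have h0 := measure_mono_null hsub hGnull
    rw [Real.volume_Ioo, show T₁ - (T₁ - 1) = (1 : ℝ) by ring, ENNReal.ofReal_one] at h0
    exact one_ne_zero h0
  have hτ₀T : τ₀ < T₁ := hτ₀I.2
  have hτ₀0 : τ₀ < 0 := lt_of_lt_of_le hτ₀T hT₁
  set G : EuclideanSpace ℝ (Fin 3) → EuclideanSpace ℝ (Fin 3) →L[ℝ] EuclideanSpace ℝ (Fin 3) := H τ₀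
    with hGdef
  have hGw : HasWeakFDerivOn (⊤ : Opens (EuclideanSpace ℝ (Fin 3))) volume v G := by
    have h := hτ₀G
    rw [hGood, mem_setOf_eq, hv τ₀ hτ₀T] at h
    exact h
  -- every good slice before `T₁` carries the same gradient (uniqueness of weak derivatives)
  have hsame : ∀ τ, τ ∈ Good → τ < T₁ → H τ =ᵐ[volume] G := by
    intro τ hτG hτT
    have h1 : HasWeakFDerivOn (⊤ : Opens (EuclideanSpace ℝ (Fin 3))) volume v (H τ) := by
      have h := hτG
      rw [hGood, mem_setOf_eq, hv τ hτT] at h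
      exact h
    have h2 := HasWeakFDerivOn.unique_holds h1 hGw
    rwa [Opens.coe_top, Measure.restrict_univ] at h2
  -- ## (2) the `E`-gauge: `∫_{B_b} |G|²_F ≤ 4 (c + 1) b^{-1-ρ}` once `b² ≥ 2 |T₁|`
  set F : ℝ × EuclideanSpace ℝ (Fin 3) → ℝ≥0∞ := fun q => ENNReal.ofReal (frobeniusNormSq (H q.1 q.2)) with hF
  have hFm : ∀ b : ℝ, AEMeasurable F
      (volume.restrict (Ioo (-(b ^ 2)) 0 ×ˢ ball (0 : EuclideanSpace ℝ (Fin 3)) b)) := by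
    intro b
    have hsub : Ioo (-(b ^ 2)) 0 ×ˢ ball (0 : EuclideanSpace ℝ (Fin 3)) b ⊆
        ((slab (EuclideanSpace ℝ (Fin 3)) (Iio 0) isOpen_Iio : Opens _) :
          Set (ℝ × EuclideanSpace ℝ (Fin 3))) := by
      rw [coe_slab]
      exact prod_mono Ioo_subset_Iio_self (subset_univ _)
    have hsm : AEStronglyMeasurable (uncurry H)
        (volume.restrict (Ioo (-(b ^ 2)) 0 ×ˢ ball (0 : EuclideanSpace ℝ (Fin 3)) b)) :=
      hH.locallyIntegrableOn_grad.aestronglyMeasurable.mono_measure (Measure.restrict_mono hsub le_rfl)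
    exact ((ENNReal.continuous_ofReal.comp continuous_frobeniusNormSq').comp_aestronglyMeasurable
      hsm).aemeasurable
  have hGsmall : ∀ b : ℝ, 0 < b → 2 * (-T₁) ≤ b ^ 2 →
      ∫⁻ y in ball (0 : EuclideanSpace ℝ (Fin 3)) b, ENNReal.ofReal (frobeniusNormSq (G y)) ≤
        ENNReal.ofReal (4 * ((c : ℝ) + 1) * b ^ (-1 - ρ)) := by
    intro b hb hbT
    set lam : ℝ≥0∞ := ENNReal.ofReal (4 * ((c : ℝ) + 1) * b ^ (-1 - ρ)) with hlam
    set e : ℝ → ℝ≥0∞ := fun τ => ∫⁻ y in ball (0 : EuclideanSpace ℝ (Fin 3)) b, F (τ, y) with he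
    set Bad : Set ℝ := {τ ∈ Ioo (-(b ^ 2)) 0 | lam ≤ e τ} with hBad
    have hcheb : lam * volume Bad ≤ ENNReal.ofReal ((c : ℝ) * b ^ (1 - ρ)) :=
      calc lam * volume Bad
          ≤ ∫⁻ q in Ioo (-(b ^ 2)) 0 ×ˢ ball (0 : EuclideanSpace ℝ (Fin 3)) b, F q :=
            Backward.mul_volume_sep_le_setLIntegral_prod (hFm b) _
        _ ≤ ENNReal.ofReal ((c : ℝ) * b ^ (1 - ρ)) :=
            TimePeriodic.setLIntegral_window_le_of_gaugeE hb le_rfl le_rfl (hE b hb)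
    -- a good, non-bad slice before `T₁` inside the window `(-b², 0)`
    obtain ⟨τ, hτI, hτG, hτB⟩ : ∃ τ, τ ∈ Ioo (-(b ^ 2)) T₁ ∧ τ ∈ Good ∧ τ ∉ Bad := by
      by_contra hne
      push Not at hne
      have hsub : Ioo (-(b ^ 2)) T₁ ⊆ Bad ∪ (Goodᶜ ∩ Iio 0) := by
        intro τ hτ
        by_cases hG' : τ ∈ Good
        · exact Or.inl (hne τ hτ hG')
        · exact Or.inr ⟨hG', lt_of_lt_of_le hτ.2 hT₁⟩
      have hvol : volume (Ioo (-(b ^ 2)) T₁) ≤ volume Bad :=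
        calc volume (Ioo (-(b ^ 2)) T₁) ≤ volume (Bad ∪ (Goodᶜ ∩ Iio 0)) := measure_mono hsub
          _ ≤ volume Bad + volume (Goodᶜ ∩ Iio 0) := measure_union_le _ _
          _ = volume Bad := by rw [hGnull, add_zero]
      have h1 : lam * ENNReal.ofReal (b ^ 2 + T₁) ≤ ENNReal.ofReal ((c : ℝ) * b ^ (1 - ρ)) :=
        calc lam * ENNReal.ofReal (b ^ 2 + T₁) = lam * volume (Ioo (-(b ^ 2)) T₁) := by
              rw [Real.volume_Ioo, show T₁ - -(b ^ 2) = b ^ 2 + T₁ by ring]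
          _ ≤ lam * volume Bad := by gcongr
          _ ≤ _ := hcheb
      have h4pos : 0 ≤ 4 * ((c : ℝ) + 1) * b ^ (-1 - ρ) := by positivity
      rw [hlam, ← ENNReal.ofReal_mul h4pos] at h1
      have h2 := (ENNReal.ofReal_le_ofReal_iff (by positivity)).1 h1
      have hpow : b ^ (-1 - ρ) * b ^ 2 = b ^ (1 - ρ) := by
        rw [show (1 - ρ : ℝ) = (-1 - ρ) + ((2 : ℕ) : ℝ) by push_cast; ring, Real.rpow_add hb,
          Real.rpow_natCast]
      have hpos : 0 < b ^ (1 - ρ) := Real.rpow_pos_of_pos hb _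
      have h3 : 4 * ((c : ℝ) + 1) * b ^ (-1 - ρ) * (b ^ 2 / 2) ≤
          4 * ((c : ℝ) + 1) * b ^ (-1 - ρ) * (b ^ 2 + T₁) := by
        gcongr
        linarith
      have h4 : 4 * ((c : ℝ) + 1) * b ^ (-1 - ρ) * (b ^ 2 / 2) = 2 * ((c : ℝ) + 1) * b ^ (1 - ρ) := by
        rw [← hpow]; ring
      have hc0 : (0 : ℝ) ≤ c := c.coe_nonneg
      nlinarith
    -- on that slice `H τ = G` a.e. and `e τ < lam`
    have heq : e τ = ∫⁻ y in ball (0 : EuclideanSpace ℝ (Fin 3)) b, ENNReal.ofReal (frobeniusNormSq (G y)) := by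
      refine lintegral_congr_ae (ae_restrict_of_ae ?_)
      filter_upwards [hsame τ hτG hτI.2] with y hy
      show ENNReal.ofReal (frobeniusNormSq (H τ y)) = ENNReal.ofReal (frobeniusNormSq (G y))
      rw [hy]
    have hlt : ¬ lam ≤ e τ := fun h => hτB ⟨⟨hτI.1, lt_of_lt_of_le hτI.2 hT₁⟩, h⟩
    rw [heq] at hlt
    exact (not_le.1 hlt).le
  -- ## hence `G = 0` a.e.
  have hGmeas : AEStronglyMeasurable G volume := by
    have h := hGw.locallyIntegrableOn_deriv.aestronglyMeasurable
    rwa [Opens.coe_top, Measure.restrict_univ] at h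
  have hlim : Tendsto (fun b : ℝ => ENNReal.ofReal (4 * ((c : ℝ) + 1) * b ^ (-1 - ρ))) atTop (𝓝 0) := by
    have h1 : Tendsto (fun b : ℝ => 4 * ((c : ℝ) + 1) * b ^ (-(1 + ρ))) atTop (𝓝 0) := by
      have h := (tendsto_rpow_neg_atTop (by linarith : 0 < 1 + ρ)).const_mul (4 * ((c : ℝ) + 1))
      simpa using h
    have h2 : (fun b : ℝ => 4 * ((c : ℝ) + 1) * b ^ (-(1 + ρ))) =
        fun b : ℝ => 4 * ((c : ℝ) + 1) * b ^ (-1 - ρ) := by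
      funext b; rw [show -(1 + ρ) = -1 - ρ by ring]
    rw [h2] at h1
    have h := ENNReal.tendsto_ofReal h1
    rwa [ENNReal.ofReal_zero] at h
  have hball : ∀ r : ℝ, 0 < r →
      ∫⁻ y in ball (0 : EuclideanSpace ℝ (Fin 3)) r, ENNReal.ofReal (frobeniusNormSq (G y)) = 0 := by
    intro r _
    refine le_antisymm (ge_of_tendsto hlim ?_) zero_le
    filter_upwards [eventually_ge_atTop r, eventually_ge_atTop (Real.sqrt (2 * (-T₁))),
      eventually_gt_atTop 0] with b hbr hbT hb0
    have hbT' : 2 * (-T₁) ≤ b ^ 2 := by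
      have h1 : Real.sqrt (2 * (-T₁)) ^ 2 = 2 * (-T₁) := Real.sq_sqrt (by linarith)
      rw [← h1]
      exact pow_le_pow_left₀ (Real.sqrt_nonneg _) hbT 2
    exact (lintegral_mono_set (ball_subset_ball hbr)).trans (hGsmall b hb0 hbT')
  -- a linear map of `ℝ³` with vanishing Frobenius norm is zero (cf. the tree's
  -- `FrequencyRigidity.TwoEndedPinning.eq_zero_of_frobeniusNormSq_eq_zero`, not imported to keep this
  -- file inside the `EulerZoomLiouville` cone)
  have hfrob0 : ∀ L : EuclideanSpace ℝ (Fin 3) →L[ℝ] EuclideanSpace ℝ (Fin 3), frobeniusNormSq L = 0 → L = 0 := by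
    intro L h
    rw [frobeniusNormSq_eq_sum (stdOrthonormalBasis ℝ (EuclideanSpace ℝ (Fin 3)))] at h
    have h0 : ∀ i, L (stdOrthonormalBasis ℝ (EuclideanSpace ℝ (Fin 3)) i) = 0 := by
      intro i
      have := (Finset.sum_eq_zero_iff_of_nonneg (fun j _ => sq_nonneg _)).1 h i (Finset.mem_univ _)
      exact norm_eq_zero.1 ((pow_eq_zero_iff two_ne_zero).1 this)
    ext1 x
    rw [← (stdOrthonormalBasis ℝ (EuclideanSpace ℝ (Fin 3))).sum_repr x, map_sum]
    simp [h0]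
  have hG0 : G =ᵐ[volume] 0 := by
    have hballae : ∀ n : ℕ, ∀ᵐ y ∂volume, y ∈ ball (0 : EuclideanSpace ℝ (Fin 3)) ((n : ℝ) + 1) → G y = 0 := by
      intro n
      have hmeas : AEMeasurable (fun y => ENNReal.ofReal (frobeniusNormSq (G y)))
          (volume.restrict (ball (0 : EuclideanSpace ℝ (Fin 3)) ((n : ℝ) + 1))) :=
        ((ENNReal.continuous_ofReal.comp continuous_frobeniusNormSq').comp_aestronglyMeasurable
          hGmeas.restrict).aemeasurable
      have h := (lintegral_eq_zero_iff' hmeas).1 (hball _ (by positivity))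
      rw [Filter.EventuallyEq, ae_restrict_iff' measurableSet_ball] at h
      filter_upwards [h] with y hy hyb
      have h1 := hy hyb
      simp only [Pi.zero_apply, ENNReal.ofReal_eq_zero] at h1
      exact hfrob0 _ (le_antisymm h1 (frobeniusNormSq_nonneg _))
    filter_upwards [ae_all_iff.2 hballae] with y hy
    obtain ⟨n, hn⟩ := exists_nat_gt ‖y‖
    exact hy n (by rw [mem_ball_zero_iff]; linarith)
  -- ## (3) `v` has the zero weak derivative, is a.e. constant, and the constant is zero
  have hW0 : HasWeakFDerivOn (⊤ : Opens (EuclideanSpace ℝ (Fin 3))) volume v 0 :=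
    { locallyIntegrableOn := hGw.locallyIntegrableOn
      locallyIntegrableOn_deriv :=
        (locallyIntegrable_const (0 : EuclideanSpace ℝ (Fin 3) →L[ℝ] EuclideanSpace ℝ (Fin 3))
          ).locallyIntegrableOn _
      integral_fderiv_smul_eq := fun φ w hφ => by
        rw [hGw.integral_fderiv_smul_eq φ w hφ]
        congr 1
        refine integral_congr_ae ?_
        filter_upwards [ae_restrict_of_ae hG0] with y hy
        rw [hy] }
  obtain ⟨b, hb⟩ := ae_eq_const_of_hasWeakFDerivOn_zero hW0
  have hb0 : b = 0 := by
    -- the `A`-gauge on the slice `τ₀` at scales `L ≥ √(−τ₀) + 1`, then the growth Liouville for constants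
    have hgrow : ∀ L : ℝ, Real.sqrt (-τ₀) + 1 ≤ L →
        ∫⁻ x in ball (0 : EuclideanSpace ℝ (Fin 3)) L, ‖(fun _ : EuclideanSpace ℝ (Fin 3) => b) x‖ₑ ^ 2 ≤
          (c : ℝ≥0∞) * ENNReal.ofReal (L ^ (1 - 2 * ρ)) := by
      intro L hL
      have hs0 : 0 ≤ Real.sqrt (-τ₀) := Real.sqrt_nonneg _
      have hL0 : 0 < L := by linarith
      have hτL : τ₀ ∈ Ioo (-(L ^ 2)) 0 := by
        refine ⟨?_, hτ₀0⟩
        have h1 : Real.sqrt (-τ₀) ^ 2 = -τ₀ := Real.sq_sqrt (by linarith)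
        have h3 : Real.sqrt (-τ₀) ^ 2 < L ^ 2 := by
          exact pow_lt_pow_left₀ (by linarith) hs0 two_ne_zero
        linarith
      have h := Backward.lintegral_ball_le_of_gaugeA hL0 (hA L hL0) hτL
      rw [hv τ₀ hτ₀T] at h
      have h' : ∫⁻ x in ball (0 : EuclideanSpace ℝ (Fin 3)) L, ‖(fun _ : EuclideanSpace ℝ (Fin 3) => b) x‖ₑ ^ 2 =
          ∫⁻ x in ball (0 : EuclideanSpace ℝ (Fin 3)) L, ‖v x‖ₑ ^ 2 := by
        refine lintegral_congr_ae (ae_restrict_of_ae ?_)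
        filter_upwards [hb] with x hx
        rw [hx]
      rw [h', ← ENNReal.ofReal_coe_nnreal, ← ENNReal.ofReal_mul c.coe_nonneg]
      exact h
    obtain ⟨C, hC, hCgrow⟩ := Shifted.growth_of_growth_le (V := fun _ : EuclideanSpace ℝ (Fin 3) => b)
      continuous_const (by linarith : 1 - 2 * ρ ≤ 3)
      (by linarith [Real.sqrt_nonneg (-τ₀)] : 1 ≤ Real.sqrt (-τ₀) + 1) ENNReal.coe_ne_top hgrow
    exact NoDrift.eq_zero_of_const_of_lintegral_ball_le hC (by linarith) hCgrow
  subst hb0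
  -- ## (4) energy-quiescent past ⇒ trivial
  refine ae_eq_zero_of_gauge_of_energyVanishing_allRho hρ.le hsw hH hc fun ε hε N => ?_
  set m : ℝ := min (-N) T₁ - 1 with hm
  have hsub : Ioo (m - 1) m ⊆ {s : ℝ | s < -N ∧ ∫⁻ x, ‖u s x‖ₑ ^ 2 ≤ ENNReal.ofReal ε} := by
    intro s hs
    have hsN : s < -N := by have := min_le_left (-N) T₁; linarith [hs.2]
    have hsT : s < T₁ := by have := min_le_right (-N) T₁; linarith [hs.2]
    refine ⟨hsN, ?_⟩
    have h0 : ∫⁻ x, ‖u s x‖ₑ ^ 2 = 0 := by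
      rw [hv s hsT]
      have h1 : ∫⁻ x, ‖v x‖ₑ ^ 2 = ∫⁻ _ : EuclideanSpace ℝ (Fin 3), (0 : ℝ≥0∞) := by
        refine lintegral_congr_ae ?_
        filter_upwards [hb] with x hx
        simp [hx]
      rw [h1, lintegral_zero]
    rw [h0]
    exact zero_le
  intro h0
  have h1 := measure_mono_null hsub h0
  rw [Real.volume_Ioo, show m - (m - 1) = (1 : ℝ) by ring, ENNReal.ofReal_one] at h1
  exact one_ne_zero h1

/-- **Past-exact self-similar members with a critically HOMOGENEOUS profile are trivial, whatever the
blow-up point.**  If a member of the class satisfies, for every `τ < T₁` (`T₁ ≤ 0`, `T₁ ≤ T`),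
`u(τ, x) = (T−τ)^{γ−1} V((x − x₀)/(T−τ)^γ)` (`γ = 1/(2+ρ)`) with `V(sy) = s^{−(1+ρ)} V(y)` for all `s > 0`
(no regularity of `V` assumed), then `u = 0` a.e. on the slab: such a collapse is time-independent
(`Shifted.selfSimilarCollapse_shifted_eq_of_homogeneous`), so the member has a steady past
(`ae_eq_zero_of_gauge_of_pastSteady`).  Closes the family "past-exact homogeneous" that the census
CENSUS-19832-v23…v27 listed as uncovered. [folklore] -/
theorem ae_eq_zero_of_gauge_of_pastHomogeneous {ρ : ℝ} (hρ : 0 < ρ)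
    {u : ℝ → EuclideanSpace ℝ (Fin 3) → EuclideanSpace ℝ (Fin 3)} {p : ℝ → EuclideanSpace ℝ (Fin 3) → ℝ}
    {H : ℝ → EuclideanSpace ℝ (Fin 3) → EuclideanSpace ℝ (Fin 3) →L[ℝ] EuclideanSpace ℝ (Fin 3)} {c : ℝ≥0}
    (hsw : IsSuitableWeakSolutionOn (slab (EuclideanSpace ℝ (Fin 3)) (Iio 0) isOpen_Iio) 0 0 u p)
    (hH : HasWeakSpatialGradientOn (slab (EuclideanSpace ℝ (Fin 3)) (Iio 0) isOpen_Iio) u H)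
    (hc : ∀ a : ℝ, 0 < a → ENNReal.ofReal (a ^ (2 * ρ)) * cknA a (0 : ℝ × EuclideanSpace ℝ (Fin 3)) u +
        ENNReal.ofReal (a ^ ρ) * cknE a (0 : ℝ × EuclideanSpace ℝ (Fin 3)) H +
        ENNReal.ofReal (a ^ (2 * ρ)) * cknD a (0 : ℝ × EuclideanSpace ℝ (Fin 3)) p ≤ (c : ℝ≥0∞))
    {T T₁ : ℝ} (hT₁ : T₁ ≤ 0) (hTT₁ : T₁ ≤ T) (x₀ : EuclideanSpace ℝ (Fin 3))
    {V : EuclideanSpace ℝ (Fin 3) → EuclideanSpace ℝ (Fin 3)}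
    (hV : ∀ s : ℝ, 0 < s → ∀ y, V (s • y) = s ^ (-(1 + ρ)) • V y)
    (hu : ∀ τ : ℝ, τ < T₁ → u τ = fun x => selfSimilarCollapse (1 / (2 + ρ)) T V τ (x - x₀)) :
    uncurry u =ᵐ[volume.restrict (Iio (0 : ℝ) ×ˢ (univ : Set (EuclideanSpace ℝ (Fin 3))))] 0 := by
  refine ae_eq_zero_of_gauge_of_pastSteady hρ hsw hH hc hT₁ (v := fun x => V (x - x₀)) fun τ hτ => ?_
  rw [hu τ hτ]
  funext x
  exact Shifted.selfSimilarCollapse_shifted_eq_of_homogeneous hρ hV (lt_of_lt_of_le hτ hTT₁) _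

end Summit.NavierStokesRegularity.NavierStokesRegularity.Theorems.PowerGaugeEulerLiouville.PastSteady
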